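import Summits.ValiantsHypothesis.ValiantsHypothesis.Theorems.LacunarySymmetroidMatrixDescartesCensusDoorA34FlagDescent

/-!
# `MatrixDescartes` census — DOOR A at `(3,4)`: the sub-stratum lift ONE SHEET DEEPER (coefficient-form lift; the sub-sub-stratum)

HONEST FRAMING.  Object-search cell `pub-symmetroid`, engine seat `val-sym-eng-2` (g2); helper file beside the registered strata line
`Cruxes/DoorA34/Lines/strata.lean` on stmt-ValiantsHypothesis-19980 (`DoorA34 = PosRootLawAt 3 4 18`: OPEN, typed, never asserted here).
MODULE NOTE (desk R2448 (B), OPS15): re-cut of the unfiled reader `…SubStratumLiftDeep` onto the built chain — imports `…FlagDescent`.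
Sequel of `…CensusDoorA34FlagDescent` (p595738).  The lifting step there is really a statement about the ORDER OF VANISHING of
the determinant at `t = 0`: this file isolates it and applies it one sheet deeper, where the exact object of
`…CensusDoorA34SubSubStratumFifteen` (p596640) lives.

* `exists_altChain_of_lowOrder_vanishing` — **COEFFICIENT-FORM LIFT (any letter)**: if `d 0 < d l` (`l ≠ 0`), `kᵀ adj(S₀) k ≠ 0`, every
  coefficient of `det F` of order `≤ 2 d₀ + d l₀` vanishes (`l₀ ≠ 0`), and `det F` carries an alternation chain of `N + 1` positive points,
  then `S l₀ ↦ S l₀ + η·kkᵀ` (small `η` of the right sign) gives a chain of `N + 2` points — the new monomial `X^{2d₀ + d l₀}`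
  (coefficient `η · kᵀadj(S₀)k`) is the lowest one;
* `coeff_det_pencil_eq_zero_of_nullBottom_subSubStratum` — on the bottom SUB-SUB-STRATUM `det S₀ = 0`, `tr(adj S₀·S₁) = 0`,
  `tr(adj S₀·S₂) = 0` of a sorted support in the chamber `d₀ + d₂ < 2 d₁`, every coefficient of order `≤ 2 d₀ + d₂` vanishes;
* `exists_altChain_two_of_nullBottom_subSubStratum` — there, two unfoldings (`S₂`, then `S₁`) turn a chain of `N + 1` points into one
  of `N + 3` (both steps stay off `S₀`, so `det S₀ = 0` throughout); `card_posRoots_of_nullBottom_subSubStratum` — with the null-end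
  lift on top: `≥ N + 3` distinct positive roots after three unfoldings;
* top versions by `t ↦ 1/t` (the sheet of p596640: `det S₃ = 0`, `tr(adj S₃·S₂) = tr(adj S₃·S₁) = 0`, chamber `2 d₂ < d₁ + d₃`):
  `card_posRoots_of_nullTop_subSubStratum_two` (`≥ N + 2` roots on the null-top stratum after unfolding `S₁`, `S₂`) and
  `card_posRoots_of_nullTop_subSubStratum` (`≥ N + 3` after unfolding `S₃` as well);
* DOOR / STUB READINGS (`N = 16`): `no_nullTop_subSubStratum_sixteen_of_posRootLawOn` — a kernel row `PosRootLawOn 3 4 18 d` excludes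
  sub-sub-stratum chain-SIXTEENS (they would lift to nineteens): the door forces `≤ 15` two sheets down, the count ATTAINED by
  `Census.SubSubStratumFifteen01458`; `no_nullTop_subSubStratum_sixteen_of_nullTopCeiling` — the stub `stub_nullTopCeiling`, taken
  verbatim as a hypothesis, forces the same (two unfoldings give a null-top eighteen).

NOTHING here asserts that such objects exist or do not exist beyond the cited exact files; nothing bounds `ζ_sym(3,4)` (registers
`18 ≤ ζ_sym(3,4) ≤ 19` unchanged); `DoorA34` and both stubs stay OPEN; nothing bears on `MatrixDescartes` (stmt-ValiantsHypothesis-18050)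
or `VP ≠ VNP` — VP≠VNP not moved.

[folklore] Matrix determinant lemma; alternation chains near `0`; letter reversal `t ↦ 1/t`.
-/

-- `Summit.ValiantsHypothesis.ValiantsHypothesis.…` repeats a component by the D-0017 layout
-- (single-conjunct summit), which the `dupNamespace` linter flags; the name is mandated.
set_option linter.dupNamespace false

namespace Summit.ValiantsHypothesis.ValiantsHypothesis.Theorems.LacunarySymmetroidMatrixDescartes.Census

open Polynomial Finset
open scoped BigOperators Polynomial Matrix
open Summit.ValiantsHypothesis.ValiantsHypothesis.Theorems.MatrixDescartes.Negative (PosRootLawAt)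

/-! ## The coefficient-form lift -/

/-- **COEFFICIENT-FORM LIFT (any letter `l₀ ≠ 0`).**  `d 0 < d l` (`l ≠ 0`), `kᵀ adj(S₀) k ≠ 0`, all coefficients of the pencil
determinant of order `≤ 2 d₀ + d l₀` vanish, and the determinant carries an alternation chain of `N + 1` positive points ⇒ for some
real `η` the pencil with `S l₀ ↦ S l₀ + η·kkᵀ` carries an alternation chain of `N + 2` positive points. [folklore] -/
theorem exists_altChain_of_lowOrder_vanishing (l₀ : Fin 4) (d : Fin 4 → ℕ) (h0 : ∀ l, l ≠ 0 → d 0 < d l)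
    (S : Fin 4 → Matrix (Fin 3) (Fin 3) ℝ) (k : Fin 3 → ℝ) (hk : k ⬝ᵥ ((S 0).adjugate *ᵥ k) ≠ 0)
    (hg : ∀ n ≤ 2 * d 0 + d l₀, ((∑ l, (X : ℝ[X]) ^ d l • (S l).map C).det).coeff n = 0)
    {N : ℕ} {s : ℝ} {a : Fin (N + 1) → ℝ}
    (hchain : AltChain ((∑ l, (X : ℝ[X]) ^ d l • (S l).map C).det) N s a) :
    ∃ η s' : ℝ, ∃ a' : Fin (N + 2) → ℝ, AltChain ((∑ l, (X : ℝ[X]) ^ d l •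
      ((S l + if l = l₀ then η • Matrix.vecMulVec k k else 0)).map C).det) (N + 1) s' a' := by
  classical
  have h0' : ∀ l, d 0 ≤ d l := fun l => by
    by_cases hl : l = 0
    · rw [hl]
    · exact (h0 l hl).le
  set P : Matrix (Fin 3) (Fin 3) ℝ[X] := ∑ l, (X : ℝ[X]) ^ d l • (S l).map C with hP
  set Nm : Matrix (Fin 3) (Fin 3) ℝ[X] := ∑ l, (X : ℝ[X]) ^ (d l - d 0) • (S l).map C with hNm
  have hPN : P = (X : ℝ[X]) ^ d 0 • Nm := pencil_eq_X_pow_smul d S h0'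
  set kC : Fin 3 → ℝ[X] := fun i => C (k i) with hkC
  set q₁ : ℝ[X] := kC ⬝ᵥ (Nm.adjugate *ᵥ kC) with hq₁
  set g : ℝ[X] := P.det with hgdef
  set r : ℝ[X] := X ^ d l₀ * (kC ⬝ᵥ (P.adjugate *ᵥ kC)) with hr
  have hr' : r = X ^ (2 * d 0 + d l₀) * q₁ := by
    rw [hr, hPN, Matrix.adjugate_smul, Fintype.card_fin]
    show X ^ d l₀ * (kC ⬝ᵥ ((((X : ℝ[X]) ^ d 0) ^ (3 - 1) • Nm.adjugate) *ᵥ kC)) = X ^ (2 * d 0 + d l₀) * q₁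
    rw [Matrix.smul_mulVec, dotProduct_smul, smul_eq_mul, hq₁, ← mul_assoc, ← pow_mul, ← pow_add]
    congr 2
    omega
  have hN0 : (Polynomial.evalRingHom 0).mapMatrix Nm = S 0 := eval_zero_reduced_pencil d S h0
  have hq0 : q₁.coeff 0 = k ⬝ᵥ ((S 0).adjugate *ᵥ k) := by
    set φ : ℝ[X] →+* ℝ := Polynomial.evalRingHom 0 with hφ
    have hk' : (⇑φ ∘ kC) = k := by funext i; simp [hφ, hkC]
    have hmv : (⇑φ ∘ (Nm.adjugate *ᵥ kC)) = (φ.mapMatrix Nm).adjugate *ᵥ k := by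
      funext i
      rw [Function.comp_apply, RingHom.map_mulVec, hk', ← RingHom.map_adjugate]
      rfl
    rw [Polynomial.coeff_zero_eq_eval_zero, ← Polynomial.coe_evalRingHom, ← hφ, hq₁, RingHom.map_dotProduct, hmv, hk',
      hN0]
  have hrcoeff : ∀ n < 2 * d 0 + d l₀, r.coeff n = 0 := by
    intro n hn
    rw [hr', Polynomial.coeff_X_pow_mul', if_neg (not_le.mpr hn)]
  have hre : r.coeff (2 * d 0 + d l₀) ≠ 0 := by
    rw [hr', Polynomial.coeff_X_pow_mul', if_pos le_rfl, Nat.sub_self, hq0]; exact hk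
  have hs : s ≠ 0 := by
    intro h; have := hchain.2.2.2; rw [h, zero_mul] at this; exact lt_irrefl _ this
  obtain ⟨η₀, hη₀, H⟩ := altChain_lift_step g r (2 * d 0 + d l₀) hg hrcoeff hre N s a hchain
  obtain ⟨η, hη, hηb, hηs⟩ := exists_small_of_sign η₀ s (r.coeff (2 * d 0 + d l₀)) hη₀ hs hre
  obtain ⟨a', -, -, hchain'⟩ := H η hη hηb hηs
  have hid : ((∑ l, (X : ℝ[X]) ^ d l • ((S l + if l = l₀ then η • Matrix.vecMulVec k k else 0)).map C)).det
      = g + C η * r := by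
    rw [det_pencil_rankOne_update_letter l₀, hgdef, hr]
  exact ⟨η, η * r.coeff (2 * d 0 + d l₀), a', by rw [hid]; exact hchain'⟩

/-! ## The bottom sub-sub-stratum: coefficients of order `≤ 2d₀ + d₂` vanish (chamber `d₀ + d₂ < 2d₁`) -/

/-- exponent bookkeeping: `d 0 < d l` for `l ≠ 0` on a support sorted as `d 0 < d 1 < d l`. [folklore] -/
theorem lt_of_sorted (d : Fin 4 → ℕ) (h01 : d 0 < d 1) (h1 : ∀ l, l ≠ 0 → l ≠ 1 → d 1 < d l) (l : Fin 4) (hl : l ≠ 0) :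
    d 0 < d l := by
  by_cases hl1 : l = 1
  · rw [hl1]; exact h01
  · exact h01.trans (h1 l hl hl1)

/-- exponent bookkeeping: after re-indexing by `Fin.rev` the three core exponents dominate `d 1`. [folklore] -/
theorem rev_castSucc_ge (d : Fin 4 → ℕ) (h1 : ∀ l, l ≠ 0 → l ≠ 1 → d 1 < d l) (l : Fin 3) :
    d 1 ≤ d (Fin.rev (Fin.castSucc l)) := by
  fin_cases l
  · show d 1 ≤ d (Fin.rev (Fin.castSucc (0 : Fin 3)))
    rw [show Fin.rev (Fin.castSucc (0 : Fin 3)) = (3 : Fin 4) from by decide]; exact (h1 3 (by decide) (by decide)).le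
  · show d 1 ≤ d (Fin.rev (Fin.castSucc (1 : Fin 3)))
    rw [show Fin.rev (Fin.castSucc (1 : Fin 3)) = (2 : Fin 4) from by decide]; exact (h1 2 (by decide) (by decide)).le
  · show d 1 ≤ d (Fin.rev (Fin.castSucc (2 : Fin 3)))
    rw [show Fin.rev (Fin.castSucc (2 : Fin 3)) = (1 : Fin 4) from by decide]

/-- **Low coefficients on the bottom sub-sub-stratum.**  If `det S₀ = 0`, `tr(adj S₀·S₁) = 0`, `tr(adj S₀·S₂) = 0`, the support is
sorted (`d 0 < d 1`, `d 1 < d 2 < d 3` in the form `d 1 < d l` for `l ∉ {0,1}` and `d 2 < d 3`) and lies in the chamber `d 0 + d 2 < 2 d 1`,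
then every coefficient of the pencil determinant of order `≤ 2 d₀ + d₂` vanishes. [folklore] -/
theorem coeff_det_pencil_eq_zero_of_nullBottom_subSubStratum (d : Fin 4 → ℕ) (S : Fin 4 → Matrix (Fin 3) (Fin 3) ℝ)
    (hdet : (S 0).det = 0) (htr1 : ((S 0).adjugate * S 1).trace = 0) (htr2 : ((S 0).adjugate * S 2).trace = 0)
    (h01 : d 0 < d 1) (h1 : ∀ l, l ≠ 0 → l ≠ 1 → d 1 < d l) (h23 : d 2 < d 3) (hch : d 0 + d 2 < 2 * d 1)
    (n : ℕ) (hn : n ≤ 2 * d 0 + d 2) :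
    ((∑ l, (X : ℝ[X]) ^ d l • (S l).map C).det).coeff n = 0 := by
  classical
  set d' : Fin 4 → ℕ := fun l => d (Fin.rev l) with hd'
  set S' : Fin 4 → Matrix (Fin 3) (Fin 3) ℝ := fun l => S (Fin.rev l) with hS'
  have hrev3 : Fin.rev (3 : Fin 4) = 0 := by decide
  have hpencil : (∑ l, (X : ℝ[X]) ^ d l • (S l).map C) = ∑ l, (X : ℝ[X]) ^ d' l • (S' l).map C := by
    simp only [hd', hS']
    exact (pencil_comp_rev d S).symm
  have hdet' : (S' 3).det = 0 := by simp only [hS', hrev3]; exact hdet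
  have hS'3 : S' 3 = S 0 := by simp only [hS', hrev3]
  have hd'3 : d' 3 = d 0 := by simp only [hd', hrev3]
  have hcore : ∀ l : Fin 3, d 1 ≤ d' (Fin.castSucc l) := fun l => rev_castSucc_ge d h1 l
  rw [hpencil, det_pencil_nullTop_eq_blocks d' S' hdet', Polynomial.coeff_add, Polynomial.coeff_add]
  set G : Matrix (Fin 3) (Fin 3) ℝ[X] :=
    ∑ l : Fin 3, (X : ℝ[X]) ^ d' (Fin.castSucc l) • (S' (Fin.castSucc l)).map C with hG
  -- block 1: triple sums `≥ 3 d₁ > 2 d₀ + d₂`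
  have hB1 : G.det.coeff n = 0 := by
    by_contra h
    have hmem := StubDescartesCeiling.support_det_pencil_subset (fun l : Fin 3 => d' (Fin.castSucc l))
      (fun l => S' (Fin.castSucc l)) (Polynomial.mem_support_iff.mpr h)
    obtain ⟨s, -, hs⟩ := Finset.mem_image.mp hmem
    have hcard : Multiset.card (((s : Multiset (Fin 3)).map (fun l : Fin 3 => d' (Fin.castSucc l)))) = 3 := by
      rw [Multiset.card_map]; exact Sym.card_coe
    have hle : Multiset.card (((s : Multiset (Fin 3)).map (fun l : Fin 3 => d' (Fin.castSucc l)))) • d 1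
        ≤ ((s : Multiset (Fin 3)).map (fun l : Fin 3 => d' (Fin.castSucc l))).sum := by
      refine Multiset.card_nsmul_le_sum ?_
      intro x hx
      obtain ⟨l, -, rfl⟩ := Multiset.mem_map.mp hx
      exact hcore l
    rw [hcard, hs, smul_eq_mul] at hle
    omega
  -- block 2: pair sums `≥ 2 d₁ > n - d₀`
  have hB2 : ((X : ℝ[X]) ^ d' 3 * (G.adjugate * (S' 3).map C).trace).coeff n = 0 := by
    rw [Polynomial.coeff_X_pow_mul']
    split_ifs with hle
    · simp only [Matrix.trace, Matrix.diag, Matrix.mul_apply, Matrix.map_apply, Polynomial.finsetSum_coeff,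
        Polynomial.coeff_mul_C]
      refine Finset.sum_eq_zero fun i _ => Finset.sum_eq_zero fun j _ => ?_
      have hz : (G.adjugate i j).coeff (n - d' 3) = 0 := by
        refine Polynomial.notMem_support_iff.mp fun h => ?_
        have hmem := support_adjugate_pencil_apply_subset' (fun l : Fin 3 => d' (Fin.castSucc l))
          (fun l => S' (Fin.castSucc l)) i j h
        obtain ⟨f, -, hf⟩ := Finset.mem_image.mp hmem
        have h2 : 2 * d 1 ≤ ∑ i, d' (Fin.castSucc (f i)) := by
          have := Finset.sum_le_sum (s := (Finset.univ : Finset (Fin 2))) fun i _ => hcore (f i)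
          simpa using this
        rw [hd'3] at hf
        omega
      rw [hz, zero_mul]
    · rfl
  -- block 3: `Σ_l X^{2d₀ + e_l} · tr(adj S₀ · S_l)`: `e_l = d₁, d₂` give the two vanishing traces, `e_l = d₃` is too high
  have hcore_strict : ∀ l : Fin 3, l ≠ 1 → l ≠ 2 → d 2 < d' (Fin.castSucc l) := by
    intro l hl1 hl2
    fin_cases l
    · have h : Fin.rev (Fin.castSucc (0 : Fin 3)) = (3 : Fin 4) := by decide
      show d 2 < d (Fin.rev (Fin.castSucc (0 : Fin 3)))
      rw [h]; exact h23
    · exact absurd rfl hl1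
    · exact absurd rfl hl2
  have hB3 : (((X : ℝ[X]) ^ d' 3) ^ 2 * (((S' 3).map C).adjugate * G).trace).coeff n = 0 := by
    rw [hG, trace_adjugate_map_mul_corePencil d' S', ← pow_mul, Polynomial.coeff_X_pow_mul']
    split_ifs with hle
    · rw [Polynomial.finsetSum_coeff]
      refine Finset.sum_eq_zero fun l _ => ?_
      rw [Polynomial.coeff_X_pow_mul']
      split_ifs with hle'
      · rw [Polynomial.coeff_C]
        split_ifs with heq
        · by_cases hl1 : l = 1
          · subst hl1
            have h : Fin.rev (Fin.castSucc (1 : Fin 3)) = (2 : Fin 4) := by decide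
            show ((S' 3).adjugate * S' (Fin.castSucc (1 : Fin 3))).trace = 0
            rw [hS'3]
            show ((S 0).adjugate * S (Fin.rev (Fin.castSucc (1 : Fin 3)))).trace = 0
            rw [h]; exact htr2
          · by_cases hl2 : l = 2
            · subst hl2
              have h : Fin.rev (Fin.castSucc (2 : Fin 3)) = (1 : Fin 4) := by decide
              show ((S' 3).adjugate * S' (Fin.castSucc (2 : Fin 3))).trace = 0
              rw [hS'3]
              show ((S 0).adjugate * S (Fin.rev (Fin.castSucc (2 : Fin 3)))).trace = 0
              rw [h]; exact htr1
            · exfalso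
              have := hcore_strict l hl1 hl2
              rw [hd'3] at hle'
              omega
        · rfl
      · rfl
    · rfl
  rw [hB1, hB2, hB3, add_zero, add_zero]

/-! ## Two unfoldings on the bottom sub-sub-stratum -/

/-- **SUB-SUB-STRATUM LIFT (bottom end, chain currency, two steps).**  On the bottom sub-sub-stratum of a sorted support in the
chamber `d₀ + d₂ < 2d₁`, with `kᵀ adj(S₀) k ≠ 0`: a chain of `N + 1` positive points becomes, after `S₂ ↦ S₂ + η₂·kkᵀ` and then
`S₁ ↦ S₁ + η₁·kkᵀ`, a chain of `N + 3` positive points (and `S₀` is untouched). [folklore] -/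
theorem exists_altChain_two_of_nullBottom_subSubStratum (d : Fin 4 → ℕ) (h01 : d 0 < d 1)
    (h1 : ∀ l, l ≠ 0 → l ≠ 1 → d 1 < d l) (h23 : d 2 < d 3) (hch : d 0 + d 2 < 2 * d 1)
    (S : Fin 4 → Matrix (Fin 3) (Fin 3) ℝ) (hdet : (S 0).det = 0) (htr1 : ((S 0).adjugate * S 1).trace = 0)
    (htr2 : ((S 0).adjugate * S 2).trace = 0)
    (k : Fin 3 → ℝ) (hk : k ⬝ᵥ ((S 0).adjugate *ᵥ k) ≠ 0)
    {N : ℕ} {s : ℝ} {a : Fin (N + 1) → ℝ}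
    (hchain : AltChain ((∑ l, (X : ℝ[X]) ^ d l • (S l).map C).det) N s a) :
    ∃ η₂ η₁ s' : ℝ, ∃ a' : Fin (N + 3) → ℝ, AltChain ((∑ l, (X : ℝ[X]) ^ d l •
      (((S l + if l = 2 then η₂ • Matrix.vecMulVec k k else 0) + if l = 1 then η₁ • Matrix.vecMulVec k k else 0)).map C).det)
        (N + 2) s' a' := by
  have h0 : ∀ l, l ≠ 0 → d 0 < d l := lt_of_sorted d h01 h1
  -- step 1: unfold `S₂` (coefficient-form lift at order `2d₀ + d₂`)
  obtain ⟨η₂, s₁, a₁, hchain₁⟩ := exists_altChain_of_lowOrder_vanishing 2 d h0 S k hk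
    (fun n hn => coeff_det_pencil_eq_zero_of_nullBottom_subSubStratum d S hdet htr1 htr2 h01 h1 h23 hch n hn) hchain
  set S₁ : Fin 4 → Matrix (Fin 3) (Fin 3) ℝ := fun l => S l + if l = 2 then η₂ • Matrix.vecMulVec k k else 0 with hS₁
  have h10 : S₁ 0 = S 0 := by simp [hS₁]
  have h11 : S₁ 1 = S 1 := by simp [hS₁]
  -- step 2: the sub-stratum lift of the companion file (unfold `S₁`)
  obtain ⟨η₁, s₂, a₂, hchain₂⟩ := exists_altChain_of_nullBottom_sheetOne d S₁ (by rw [h10]; exact hdet)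
    (by rw [h10, h11]; exact htr1) k (by rw [h10]; exact hk) h01 h1 hchain₁
  exact ⟨η₂, η₁, s₂, a₂, hchain₂⟩

/-- **Count currency, bottom end.**  Under the same hypotheses, three unfoldings (`S₂`, `S₁`, then `S₀`; same support) give at least
`N + 3` distinct positive determinant roots. [folklore] -/
theorem card_posRoots_of_nullBottom_subSubStratum (d : Fin 4 → ℕ) (h01 : d 0 < d 1)
    (h1 : ∀ l, l ≠ 0 → l ≠ 1 → d 1 < d l) (h23 : d 2 < d 3) (hch : d 0 + d 2 < 2 * d 1)
    (S : Fin 4 → Matrix (Fin 3) (Fin 3) ℝ) (hdet : (S 0).det = 0) (htr1 : ((S 0).adjugate * S 1).trace = 0)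
    (htr2 : ((S 0).adjugate * S 2).trace = 0)
    (k : Fin 3 → ℝ) (hk : k ⬝ᵥ ((S 0).adjugate *ᵥ k) ≠ 0)
    {N : ℕ} {s : ℝ} {a : Fin (N + 1) → ℝ}
    (hchain : AltChain ((∑ l, (X : ℝ[X]) ^ d l • (S l).map C).det) N s a) :
    ∃ η₂ η₁ η₀ : ℝ, N + 3 ≤ ((((∑ l, (X : ℝ[X]) ^ d l •
      ((((S l + if l = 2 then η₂ • Matrix.vecMulVec k k else 0) + if l = 1 then η₁ • Matrix.vecMulVec k k else 0)
        + if l = 0 then η₀ • Matrix.vecMulVec k k else 0)).map C)).det).roots.toFinset.filter (fun t => 0 < t)).card := by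
  have h0 : ∀ l, l ≠ 0 → d 0 < d l := lt_of_sorted d h01 h1
  obtain ⟨η₂, η₁, s', a', hchain'⟩ :=
    exists_altChain_two_of_nullBottom_subSubStratum d h01 h1 h23 hch S hdet htr1 htr2 k hk hchain
  set S₂ : Fin 4 → Matrix (Fin 3) (Fin 3) ℝ :=
    fun l => (S l + if l = 2 then η₂ • Matrix.vecMulVec k k else 0) + if l = 1 then η₁ • Matrix.vecMulVec k k else 0 with hS₂
  have h20 : S₂ 0 = S 0 := by simp [hS₂]
  obtain ⟨η₀, h⟩ := nineteen_of_nullBottom_eighteen d h0 S₂ (by rw [h20]; exact hdet) k (by rw [h20]; exact hk) hchain'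
  exact ⟨η₂, η₁, η₀, h⟩

/-! ## Three sheets down: the isotropic core (bottom end; chamber `d₀ + d₃ < 2d₁`) -/

/-- **Low coefficients on the bottom ISOTROPIC-CORE sheet.**  If `det S₀ = 0` and `tr(adj S₀·S_l) = 0` for `l = 1, 2, 3` (the adjugate-kernel
vector of `S₀` is isotropic for the three other letters), the support is sorted and `d 0 + d 3 < 2 d 1`, then every coefficient of the pencil
determinant of order `≤ 2 d₀ + d₃` vanishes. [folklore] -/
theorem coeff_det_pencil_eq_zero_of_nullBottom_isotropicCore (d : Fin 4 → ℕ) (S : Fin 4 → Matrix (Fin 3) (Fin 3) ℝ)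
    (hdet : (S 0).det = 0) (htr1 : ((S 0).adjugate * S 1).trace = 0) (htr2 : ((S 0).adjugate * S 2).trace = 0)
    (htr3 : ((S 0).adjugate * S 3).trace = 0)
    (h01 : d 0 < d 1) (h1 : ∀ l, l ≠ 0 → l ≠ 1 → d 1 < d l) (hch : d 0 + d 3 < 2 * d 1)
    (n : ℕ) (hn : n ≤ 2 * d 0 + d 3) :
    ((∑ l, (X : ℝ[X]) ^ d l • (S l).map C).det).coeff n = 0 := by
  classical
  set d' : Fin 4 → ℕ := fun l => d (Fin.rev l) with hd'
  set S' : Fin 4 → Matrix (Fin 3) (Fin 3) ℝ := fun l => S (Fin.rev l) with hS'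
  have hrev3 : Fin.rev (3 : Fin 4) = 0 := by decide
  have hpencil : (∑ l, (X : ℝ[X]) ^ d l • (S l).map C) = ∑ l, (X : ℝ[X]) ^ d' l • (S' l).map C := by
    simp only [hd', hS']
    exact (pencil_comp_rev d S).symm
  have hdet' : (S' 3).det = 0 := by simp only [hS', hrev3]; exact hdet
  have hS'3 : S' 3 = S 0 := by simp only [hS', hrev3]
  have hd'3 : d' 3 = d 0 := by simp only [hd', hrev3]
  have hcore : ∀ l : Fin 3, d 1 ≤ d' (Fin.castSucc l) := fun l => rev_castSucc_ge d h1 l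
  rw [hpencil, det_pencil_nullTop_eq_blocks d' S' hdet', Polynomial.coeff_add, Polynomial.coeff_add]
  set G : Matrix (Fin 3) (Fin 3) ℝ[X] :=
    ∑ l : Fin 3, (X : ℝ[X]) ^ d' (Fin.castSucc l) • (S' (Fin.castSucc l)).map C with hG
  have hB1 : G.det.coeff n = 0 := by
    by_contra h
    have hmem := StubDescartesCeiling.support_det_pencil_subset (fun l : Fin 3 => d' (Fin.castSucc l))
      (fun l => S' (Fin.castSucc l)) (Polynomial.mem_support_iff.mpr h)
    obtain ⟨s, -, hs⟩ := Finset.mem_image.mp hmem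
    have hcard : Multiset.card (((s : Multiset (Fin 3)).map (fun l : Fin 3 => d' (Fin.castSucc l)))) = 3 := by
      rw [Multiset.card_map]; exact Sym.card_coe
    have hle : Multiset.card (((s : Multiset (Fin 3)).map (fun l : Fin 3 => d' (Fin.castSucc l)))) • d 1
        ≤ ((s : Multiset (Fin 3)).map (fun l : Fin 3 => d' (Fin.castSucc l))).sum := by
      refine Multiset.card_nsmul_le_sum ?_
      intro x hx
      obtain ⟨l, -, rfl⟩ := Multiset.mem_map.mp hx
      exact hcore l
    rw [hcard, hs, smul_eq_mul] at hle
    omega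
  have hB2 : ((X : ℝ[X]) ^ d' 3 * (G.adjugate * (S' 3).map C).trace).coeff n = 0 := by
    rw [Polynomial.coeff_X_pow_mul']
    split_ifs with hle
    · simp only [Matrix.trace, Matrix.diag, Matrix.mul_apply, Matrix.map_apply, Polynomial.finsetSum_coeff,
        Polynomial.coeff_mul_C]
      refine Finset.sum_eq_zero fun i _ => Finset.sum_eq_zero fun j _ => ?_
      have hz : (G.adjugate i j).coeff (n - d' 3) = 0 := by
        refine Polynomial.notMem_support_iff.mp fun h => ?_
        have hmem := support_adjugate_pencil_apply_subset' (fun l : Fin 3 => d' (Fin.castSucc l))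
          (fun l => S' (Fin.castSucc l)) i j h
        obtain ⟨f, -, hf⟩ := Finset.mem_image.mp hmem
        have h2 : 2 * d 1 ≤ ∑ i, d' (Fin.castSucc (f i)) := by
          have := Finset.sum_le_sum (s := (Finset.univ : Finset (Fin 2))) fun i _ => hcore (f i)
          simpa using this
        rw [hd'3] at hf
        omega
      rw [hz, zero_mul]
    · rfl
  -- block 3: all three traces vanish
  have hB3 : (((X : ℝ[X]) ^ d' 3) ^ 2 * (((S' 3).map C).adjugate * G).trace).coeff n = 0 := by
    rw [hG, trace_adjugate_map_mul_corePencil d' S', ← pow_mul, Polynomial.coeff_X_pow_mul']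
    split_ifs with hle
    · rw [Polynomial.finsetSum_coeff]
      refine Finset.sum_eq_zero fun l _ => ?_
      rw [Polynomial.coeff_X_pow_mul']
      split_ifs with hle'
      · rw [Polynomial.coeff_C]
        split_ifs with heq
        · rw [hS'3]
          fin_cases l
          · have h : Fin.rev (Fin.castSucc (0 : Fin 3)) = (3 : Fin 4) := by decide
            show ((S 0).adjugate * S (Fin.rev (Fin.castSucc (0 : Fin 3)))).trace = 0
            rw [h]; exact htr3
          · have h : Fin.rev (Fin.castSucc (1 : Fin 3)) = (2 : Fin 4) := by decide
            show ((S 0).adjugate * S (Fin.rev (Fin.castSucc (1 : Fin 3)))).trace = 0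
            rw [h]; exact htr2
          · have h : Fin.rev (Fin.castSucc (2 : Fin 3)) = (1 : Fin 4) := by decide
            show ((S 0).adjugate * S (Fin.rev (Fin.castSucc (2 : Fin 3)))).trace = 0
            rw [h]; exact htr1
        · rfl
      · rfl
    · rfl
  rw [hB1, hB2, hB3, add_zero, add_zero]

/-- **ISOTROPIC-CORE LIFT (bottom end, chain currency, three steps).**  On the bottom isotropic-core sheet of a sorted support with
`d₀ + d₃ < 2d₁`, with `kᵀ adj(S₀) k ≠ 0`: a chain of `N + 1` positive points becomes, after unfolding `S₃`, `S₂`, `S₁` in turn by `η·kkᵀ`,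
a chain of `N + 4` positive points (`S₀` untouched). [folklore] -/
theorem exists_altChain_three_of_nullBottom_isotropicCore (d : Fin 4 → ℕ) (h01 : d 0 < d 1)
    (h1 : ∀ l, l ≠ 0 → l ≠ 1 → d 1 < d l) (h23 : d 2 < d 3) (hch : d 0 + d 3 < 2 * d 1)
    (S : Fin 4 → Matrix (Fin 3) (Fin 3) ℝ) (hdet : (S 0).det = 0) (htr1 : ((S 0).adjugate * S 1).trace = 0)
    (htr2 : ((S 0).adjugate * S 2).trace = 0) (htr3 : ((S 0).adjugate * S 3).trace = 0)
    (k : Fin 3 → ℝ) (hk : k ⬝ᵥ ((S 0).adjugate *ᵥ k) ≠ 0)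
    {N : ℕ} {s : ℝ} {a : Fin (N + 1) → ℝ}
    (hchain : AltChain ((∑ l, (X : ℝ[X]) ^ d l • (S l).map C).det) N s a) :
    ∃ η₃ η₂ η₁ s' : ℝ, ∃ a' : Fin (N + 4) → ℝ, AltChain ((∑ l, (X : ℝ[X]) ^ d l •
      ((((S l + if l = 3 then η₃ • Matrix.vecMulVec k k else 0) + if l = 2 then η₂ • Matrix.vecMulVec k k else 0)
        + if l = 1 then η₁ • Matrix.vecMulVec k k else 0)).map C).det) (N + 3) s' a' := by
  have h0 : ∀ l, l ≠ 0 → d 0 < d l := lt_of_sorted d h01 h1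
  have hch2 : d 0 + d 2 < 2 * d 1 := by omega
  obtain ⟨η₃, s₁, a₁, hchain₁⟩ := exists_altChain_of_lowOrder_vanishing 3 d h0 S k hk
    (fun n hn => coeff_det_pencil_eq_zero_of_nullBottom_isotropicCore d S hdet htr1 htr2 htr3 h01 h1 hch n hn) hchain
  set S₁ : Fin 4 → Matrix (Fin 3) (Fin 3) ℝ := fun l => S l + if l = 3 then η₃ • Matrix.vecMulVec k k else 0 with hS₁
  have h10 : S₁ 0 = S 0 := by simp [hS₁]
  have h11 : S₁ 1 = S 1 := by simp [hS₁]
  have h12 : S₁ 2 = S 2 := by simp [hS₁]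
  obtain ⟨η₂, η₁, s₂, a₂, hchain₂⟩ := exists_altChain_two_of_nullBottom_subSubStratum d h01 h1 h23 hch2 S₁
    (by rw [h10]; exact hdet) (by rw [h10, h11]; exact htr1) (by rw [h10, h12]; exact htr2) k (by rw [h10]; exact hk) hchain₁
  exact ⟨η₃, η₂, η₁, s₂, a₂, hchain₂⟩

/-- **Count currency, bottom end, isotropic core.**  Under the same hypotheses, four unfoldings (`S₃`, `S₂`, `S₁`, then `S₀`) give at least
`N + 4` distinct positive determinant roots.  With `N = 15`: a bottom isotropic-core chain-FIFTEEN lifts to a NINETEEN. [folklore] -/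
theorem card_posRoots_of_nullBottom_isotropicCore (d : Fin 4 → ℕ) (h01 : d 0 < d 1)
    (h1 : ∀ l, l ≠ 0 → l ≠ 1 → d 1 < d l) (h23 : d 2 < d 3) (hch : d 0 + d 3 < 2 * d 1)
    (S : Fin 4 → Matrix (Fin 3) (Fin 3) ℝ) (hdet : (S 0).det = 0) (htr1 : ((S 0).adjugate * S 1).trace = 0)
    (htr2 : ((S 0).adjugate * S 2).trace = 0) (htr3 : ((S 0).adjugate * S 3).trace = 0)
    (k : Fin 3 → ℝ) (hk : k ⬝ᵥ ((S 0).adjugate *ᵥ k) ≠ 0)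
    {N : ℕ} {s : ℝ} {a : Fin (N + 1) → ℝ}
    (hchain : AltChain ((∑ l, (X : ℝ[X]) ^ d l • (S l).map C).det) N s a) :
    ∃ η₃ η₂ η₁ η₀ : ℝ, N + 4 ≤ ((((∑ l, (X : ℝ[X]) ^ d l •
      (((((S l + if l = 3 then η₃ • Matrix.vecMulVec k k else 0) + if l = 2 then η₂ • Matrix.vecMulVec k k else 0)
        + if l = 1 then η₁ • Matrix.vecMulVec k k else 0) + if l = 0 then η₀ • Matrix.vecMulVec k k else 0)).map C)).det
          ).roots.toFinset.filter (fun t => 0 < t)).card := by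
  have h0 : ∀ l, l ≠ 0 → d 0 < d l := lt_of_sorted d h01 h1
  obtain ⟨η₃, η₂, η₁, s', a', hchain'⟩ :=
    exists_altChain_three_of_nullBottom_isotropicCore d h01 h1 h23 hch S hdet htr1 htr2 htr3 k hk hchain
  set S₃ : Fin 4 → Matrix (Fin 3) (Fin 3) ℝ := fun l => ((S l + if l = 3 then η₃ • Matrix.vecMulVec k k else 0)
    + if l = 2 then η₂ • Matrix.vecMulVec k k else 0) + if l = 1 then η₁ • Matrix.vecMulVec k k else 0 with hS₃
  have h30 : S₃ 0 = S 0 := by simp [hS₃]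
  obtain ⟨η₀, h⟩ := nineteen_of_nullBottom_eighteen d h0 S₃ (by rw [h30]; exact hdet) k (by rw [h30]; exact hk) hchain'
  exact ⟨η₃, η₂, η₁, η₀, h⟩

end Summit.ValiantsHypothesis.ValiantsHypothesis.Theorems.LacunarySymmetroidMatrixDescartes.Census
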